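import Mathlib.LinearAlgebra.FiniteDimensional.Lemmas
import Mathlib.Algebra.BigOperators.Pi
import Mathlib.Logic.Equiv.Prod
import HarnessLib

/-!
# GCT I §8: the wreath-product module `Y = E ⊕ F ⊕ H` behind the stability of `E(X)`
# (Mulmuley–Sohoni 2001, proof of Thm. 7.3, first half — the part that does not use Kempf)

Mulmuley–Sohoni prove the stability of the form `E(X) = ∏_σ det_σ(X)` (GCT I §7, the tree's
`msE F m k : MvPolynomial (Fin m × (Fin m × Fin k)) F`; Thm. 7.3 = the typed fact
`MS2001_thm_7_3`) in §8 in two halves. The FIRST half (AV p. 34–35, all.txt L2527–2700) is pure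
finite-group linear algebra and is formalised here, as THEOREMS over an arbitrary field `K`
(no named fact is introduced; D-0026):

«Let `I` denote the set `{(i, j) | 1 ≤ i ≤ 3, 1 ≤ j ≤ m}` … Let `D` denote the wreath-product of
`S_m` with `S_3`. An element of `D` is given by a tuple `β = (σ; α_1, …, α_m)` where `σ ∈ S_m` and
each `α_i ∈ S_3`. `D` acts on `I` naturally … Let `Y` be the vector space consisting of formal
linear combinations of the symbols `{y_ij | (i, j) ∈ I}`. `D` acts on `Y` naturally, viz.
`β(y_ij) = y_{β(i,j)}`. … Let `e' = Σ_{(i,j) ∈ I} y_ij` and `f'_j = y_1j + y_2j + y_3j`. Let `E` be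
the span of `e'` and `F` be the span of all vectors of the form `{f'_r − f'_s | 1 ≤ r, s ≤ m}`. It
is clear that `E`, `F` are invariant under the action of `D`. We claim that `E` and `F` are, in
fact, irreducible representations of `D`. … `F = {Σ_r c_r f'_r | Σ_r c_r = 0}` …
`H = {Σ c_ij y_ij | c_1j + c_2j + c_3j = 0 ∀ j}`. It is easy to show that `H` is also
`D`-irreducible. Thus we see that the `D`-module `Y` splits into irreducible components
`Y = E ⊕ F ⊕ H` as `D`-modules and thus `Y` is a multiplicity-free representation of `D`. …
Let `h'_1j = 2 y_1j − y_2j − y_3j` … We may check that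
  `3m · y_ij = e' + Σ_{r : r ≠ i} (f'_i − f'_r) + m · h'_ij`            (14)»
(MS write `k = 3` «for simplicity»; everything is done here for general `k`.)

## Dictionary (the tree's indexing of `msE`)

The columns of the variable matrix `X` of `msE F m k` are indexed by `Fin m × Fin k` = (column
GROUP `i`, position `j` inside the group); MS's `(i, j) ∈ I` is (position, group). We work with an
arbitrary finite GROUP type `α` (MS: `{1, …, m}`) and POSITION type `β` (MS: `{1, 2, 3}`), so
`Y = (α × β → K)`, and the wreath product `D = S_α ≀ S_β` acts on `α × β` through MATHLIB's
`Equiv.prodShear κ π : (i, j) ↦ (κ i, π_i j)` (`κ : Equiv.Perm α`, `π : α → Equiv.Perm β`); the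
subgroup they form is `wreathProduct α β`. (On the variables of `msE` these are the column parts of
the relabellings `MS2001Thm73.relabel ρ κ π` of `MS2001FormEPolystableComplex.lean`, under which
`E(X)` is a relative invariant, `rename_relabel_msE`.) A vector `y : α × β → K` is acted on by
`y ↦ y ∘ w` (`w ∈ D`; since `D` is a group, stability of a subspace under all `y ↦ y ∘ w` is the
same as under all `y ↦ y ∘ w⁻¹`, MS's `β(y_ij) = y_{β(i,j)}`).

* `E = subE K α β = K ∙ 𝟙` (`𝟙 = e'`), `F = subF K α β` = the group-constant vectors with total `0`
  (spanned by the `groupInd K β i − groupInd K β i'`, `groupInd K β i = f'_i` the indicator of group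
  `i`), `H = subH K α β` = the vectors all of whose group sums vanish (`hVec K (i, j) = h'_ij =
  k · δ_(i,j) − f'_i ∈ H`).

## Main statements

* § 1 the group `D`: `prodShear_mul`, `prodShear_inv`, `wreathProduct` (and, as private lemmas,
  its transitivity on points, on pairs inside a group and on pairs in different groups — the three
  orbits of `D` on `(α × β)²` that drive § 4).
* § 2 `E`, `F`, `H`, their `D`-stability (`isWreathStable_subE/F/H`; «It is clear that `E`, `F` are
  invariant under the action of `D`»), and the fixed vectors `Y^D = E`
  (`forall_comp_prodShear_eq_iff`).
* § 3 eq. (14) (`card_mul_card_smul_single_eq`, and its «unprimed» vector form (17),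
  `card_mul_card_smul_apply_eq`, valid in every `K`-module); the `D`-equivariant projections
  `projE`, `projF`, `projH` with `projE + projF + projH = id`, and — when `k = |β|` and `m = |α|` are
  nonzero in `K` (MS: «the characteristic does not divide `m`, `k`») — the decomposition
  `Y = E ⊕ F ⊕ H` (`subE_sup_subF_sup_subH_eq_top`, the pairwise-`⊥` intersections) with
  `dim E = 1`, `dim F = m − 1`, `dim H = m (k − 1)` (`finrank_subE/F/H`; MS: «`dim(E) = 1`,
  `dim(F) = m − 1` and `dim(H) = 2m`» at `k = 3`).
* § 4 multiplicity-freeness in the two forms a Kempf-type argument consumes: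
  (a) **`exists_eq_of_commute_prodShear`**: every `K`-linear endomorphism of `Y` commuting with `D`
  is `y ↦ a·y + b·(group sums of y) + c·(total of y)·𝟙`, hence acts by a SCALAR on each of `E`,
  `F`, `H` (`exists_smul_of_commute_*`; MS (15): «since `λ` commutes with `D'` … `λ'(t)(3m·y_ij) =
  t^a e' + t^b Σ_r (f'_i − f'_r) + t^c m h'_ij`») — over every field, with no hypothesis on the
  characteristic;
  (b) **`exists_eq_sup_of_isWreathStable`**: every `D`-stable subspace of `Y` is one of the eight
  sums of `E`, `F`, `H`, and `E`, `F`, `H` are `D`-irreducible (`eq_bot_or_eq_sub*_of_le`) — under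
  `(k : K) ≠ 0`, `(m : K) ≠ 0`.

Scope notes. (i) MS's remark that the smaller group `D' = A_m ≀ S_3` still acts irreducibly on
`E`, `F`, `H` «for `m > 4`» is not formalised (the full wreath product suffices for the relabelling
symmetries of `E(X)`, which include a compensating row permutation: `rename_relabel_msE` with
`ρ = κ`). (ii) The SECOND half of §8 (Kempf's criterion, eqs. (15)–(19) and the weight analysis of
`E(X)`, AV p. 35–37) is not in this file; it is the business of the discharge of `MS2001_thm_7_3`.
Nothing here bears on VP versus VNP.

## References

* [MulmuleySohoniSIAM2001] K. D. Mulmuley, M. Sohoni, *Geometric complexity theory I: an approach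
  to the P vs. NP and related problems*, SIAM J. Comput. 31 (2001) 496–526; authors' version
  (2001-04-23) §8, p. 34–35 (all.txt L2527–2700), eq. (14).

## Provenance

Cell `val-lit`, seat `val-lit-t02` generation 8 (row MS2001-A, lead-bip ruling #67 (4)).
-/

noncomputable section

open Finset

namespace Literature.Computability.AlgebraicComplexity

namespace MS2001Wreath

variable {K : Type*} [Field K]
variable {α β : Type*} [Fintype α] [Fintype β] [DecidableEq α] [DecidableEq β]

/-! ## § 1. The wreath product `D = S_α ≀ S_β` acting on `α × β` -/

section Group

omit [Fintype α] [Fintype β] [DecidableEq α] [DecidableEq β] in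
/-- Unfolding MATHLIB's `Equiv.prodShear`: `(κ; π)(i, j) = (κ i, π_i j)` — MS's
«`β = (σ; (α_r))(i, j) = (α_j(i), σ(j))`» in the tree's (group, position) order.
[cite: MulmuleySohoniSIAM2001, §8 (AV p.34, all.txt L2548–2551)] -/
theorem prodShear_apply_mk (κ : Equiv.Perm α) (π : α → Equiv.Perm β) (i : α) (j : β) :
    Equiv.prodShear κ π (i, j) = (κ i, π i j) := rfl

omit [Fintype α] [Fintype β] [DecidableEq α] [DecidableEq β] in
/-- The identity of `D` («an element of `D` is given by a tuple `(σ; α_1, …, α_m)`»). [cite: MulmuleySohoniSIAM2001, §8 (AV p.34, all.txt L2546–2551)] -/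
theorem prodShear_one : Equiv.prodShear (1 : Equiv.Perm α) (fun _ => (1 : Equiv.Perm β)) = 1 :=
  Equiv.ext fun _ => rfl

omit [Fintype α] [Fintype β] [DecidableEq α] [DecidableEq β] in
/-- The multiplication of the wreath product: `(κ; π) · (κ'; π') = (κ κ'; i ↦ π_{κ' i} π'_i)`.
[cite: MulmuleySohoniSIAM2001, §8 (AV p.34, all.txt L2546–2551)] -/
theorem prodShear_mul (κ κ' : Equiv.Perm α) (π π' : α → Equiv.Perm β) :
    Equiv.prodShear κ π * Equiv.prodShear κ' π' =
      Equiv.prodShear (κ * κ') (fun i => π (κ' i) * π' i) :=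
  Equiv.ext fun _ => rfl

omit [Fintype α] [Fintype β] [DecidableEq α] [DecidableEq β] in
/-- The inverse in the wreath product: `(κ; π)⁻¹ = (κ⁻¹; i ↦ (π_{κ⁻¹ i})⁻¹)`.
[cite: MulmuleySohoniSIAM2001, §8 (AV p.34, all.txt L2546–2551)] -/
theorem prodShear_inv (κ : Equiv.Perm α) (π : α → Equiv.Perm β) :
    (Equiv.prodShear κ π)⁻¹ = Equiv.prodShear κ⁻¹ (fun i => (π (κ⁻¹ i))⁻¹) :=
  Equiv.ext fun _ => rfl

variable (α β) in
/-- **The wreath product `D = S_α ≀ S_β`** as the subgroup of permutations of `α × β` of the form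
`(i, j) ↦ (κ i, π_i j)` («the wreath-product of `S_m` with `S_3` … `D` acts on `I` naturally»).
[cite: MulmuleySohoniSIAM2001, §8 (AV p.34, all.txt L2546–2551)] -/
def wreathProduct : Subgroup (Equiv.Perm (α × β)) where
  carrier := {w | ∃ (κ : Equiv.Perm α) (π : α → Equiv.Perm β), w = Equiv.prodShear κ π}
  mul_mem' := by
    rintro _ _ ⟨κ, π, rfl⟩ ⟨κ', π', rfl⟩
    exact ⟨κ * κ', fun i => π (κ' i) * π' i, prodShear_mul κ κ' π π'⟩
  one_mem' := ⟨1, fun _ => 1, prodShear_one.symm⟩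
  inv_mem' := by
    rintro _ ⟨κ, π, rfl⟩
    exact ⟨κ⁻¹, fun i => (π (κ⁻¹ i))⁻¹, prodShear_inv κ π⟩

omit [Fintype α] [Fintype β] [DecidableEq α] [DecidableEq β] in
/-- Membership in `wreathProduct`. [cite: MulmuleySohoniSIAM2001, §8 (AV p.34, all.txt L2546–2551)] -/
theorem mem_wreathProduct_iff (w : Equiv.Perm (α × β)) :
    w ∈ wreathProduct α β ↔ ∃ (κ : Equiv.Perm α) (π : α → Equiv.Perm β), w = Equiv.prodShear κ π :=
  Iff.rfl

omit [Fintype α] [Fintype β] [DecidableEq α] [DecidableEq β] in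
/-- The generators lie in `wreathProduct`. [cite: MulmuleySohoniSIAM2001, §8 (AV p.34, all.txt L2546–2551)] -/
theorem prodShear_mem_wreathProduct (κ : Equiv.Perm α) (π : α → Equiv.Perm β) :
    Equiv.prodShear κ π ∈ wreathProduct α β :=
  ⟨κ, π, rfl⟩

omit [Fintype α] [Fintype β] [DecidableEq α] [DecidableEq β] in
/-- Elements of `D` preserve the partition of `α × β` into groups `{i} × β` («`D` acts on `I`
naturally»). [cite: MulmuleySohoniSIAM2001, §8 (AV p.34, all.txt L2546–2551)] -/
theorem fst_eq_iff_of_mem_wreathProduct {w : Equiv.Perm (α × β)} (hw : w ∈ wreathProduct α β)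
    (p q : α × β) : (w p).1 = (w q).1 ↔ p.1 = q.1 := by
  obtain ⟨κ, π, rfl⟩ := hw
  simp [Equiv.prodShear_apply, κ.injective.eq_iff]

/-- Two-point transitivity of the symmetric group: distinct `a ≠ b` can be sent to any distinct
`c ≠ d` by a permutation. [folklore] -/
private theorem exists_perm_apply_eq_and {γ : Type*} [DecidableEq γ] {a b c d : γ} (hab : a ≠ b)
    (hcd : c ≠ d) : ∃ σ : Equiv.Perm γ, σ a = c ∧ σ b = d := by
  refine ⟨Equiv.swap (Equiv.swap a c b) d * Equiv.swap a c, ?_, ?_⟩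
  · have h1 : Equiv.swap a c b ≠ c := by
      intro h
      have : Equiv.swap a c b = Equiv.swap a c a := by rw [h, Equiv.swap_apply_left]
      exact hab ((Equiv.swap a c).injective this).symm
    rw [Equiv.Perm.mul_apply, Equiv.swap_apply_left,
      Equiv.swap_apply_of_ne_of_ne h1.symm hcd]
  · rw [Equiv.Perm.mul_apply, Equiv.swap_apply_left]

omit [Fintype α] [Fintype β] in
/-- `D` is transitive on `α × β`. [folklore] -/
private theorem exists_prodShear_apply_eq (p q : α × β) :
    ∃ (κ : Equiv.Perm α) (π : α → Equiv.Perm β), Equiv.prodShear κ π p = q :=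
  ⟨Equiv.swap p.1 q.1, fun _ => Equiv.swap p.2 q.2, by simp [Equiv.prodShear_apply]⟩

omit [Fintype α] [Fintype β] in
/-- `D` is transitive on the ordered pairs of DISTINCT points lying in a common group.
[folklore] -/
private theorem exists_prodShear_apply_eq_of_fst_eq {p p' q q' : α × β} (hp : p.1 = p'.1) (hpne : p ≠ p')
    (hq : q.1 = q'.1) (hqne : q ≠ q') :
    ∃ (κ : Equiv.Perm α) (π : α → Equiv.Perm β),
      Equiv.prodShear κ π p = q ∧ Equiv.prodShear κ π p' = q' := by
  have hp2 : p.2 ≠ p'.2 := fun h => hpne (Prod.ext hp h)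
  have hq2 : q.2 ≠ q'.2 := fun h => hqne (Prod.ext hq h)
  obtain ⟨σ, hσ1, hσ2⟩ := exists_perm_apply_eq_and hp2 hq2
  refine ⟨Equiv.swap p.1 q.1, fun _ => σ, ?_, ?_⟩
  · exact Prod.ext (by simp [Equiv.prodShear_apply]) (by simpa [Equiv.prodShear_apply] using hσ1)
  · refine Prod.ext ?_ (by simpa [Equiv.prodShear_apply] using hσ2)
    simp [Equiv.prodShear_apply, ← hp, hq]

omit [Fintype α] [Fintype β] in
/-- `D` is transitive on the ordered pairs of points lying in DIFFERENT groups. [folklore] -/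
private theorem exists_prodShear_apply_eq_of_fst_ne {p p' q q' : α × β} (hp : p.1 ≠ p'.1)
    (hq : q.1 ≠ q'.1) :
    ∃ (κ : Equiv.Perm α) (π : α → Equiv.Perm β),
      Equiv.prodShear κ π p = q ∧ Equiv.prodShear κ π p' = q' := by
  obtain ⟨κ, hκ1, hκ2⟩ := exists_perm_apply_eq_and hp hq
  refine ⟨κ, fun i => if i = p.1 then Equiv.swap p.2 q.2 else Equiv.swap p'.2 q'.2, ?_, ?_⟩
  · exact Prod.ext (by simpa [Equiv.prodShear_apply] using hκ1) (by simp [Equiv.prodShear_apply])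
  · refine Prod.ext (by simpa [Equiv.prodShear_apply] using hκ2) ?_
    simp [Equiv.prodShear_apply, Ne.symm hp]

end Group

/-! ## § 2. The module `Y = (α × β → K)`, the subspaces `E`, `F`, `H`, and their `D`-stability -/

section Module

variable (K β) in
/-- `f'_i`: the indicator vector of the group `{i} × β` (MS: «`f'_j = y_1j + y_2j + y_3j`»).
[cite: MulmuleySohoniSIAM2001, §8 (AV p.34, all.txt L2566)] -/
def groupInd (i : α) : α × β → K := fun p => if p.1 = i then 1 else 0

variable (K) in
/-- `h'_ij = k · y_ij − f'_i` (MS at `k = 3`: «`h'_1j = 2y_1j − y_2j − y_3j`»).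
[cite: MulmuleySohoniSIAM2001, §8 (AV p.35, all.txt L2700)] -/
def hVec (p : α × β) : α × β → K :=
  (Fintype.card β : K) • (Pi.single p 1 : α × β → K) - groupInd K β p.1

variable (K α β) in
/-- `E` = the span of `e' = Σ_{(i,j)} y_ij` (the constant vectors).
[cite: MulmuleySohoniSIAM2001, §8 (AV p.34, all.txt L2566–2569)] -/
def subE : Submodule K (α × β → K) := K ∙ (1 : α × β → K)

variable (K α β) in
/-- `F` = «the span of all vectors of the form `f'_r − f'_s`» = «`{Σ_r c_r f'_r | Σ_r c_r = 0}`»: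
the vectors that are constant on every group and have total sum `0`.
[cite: MulmuleySohoniSIAM2001, §8 (AV p.34, all.txt L2566–2590)] -/
def subF : Submodule K (α × β → K) where
  carrier := {y | (∀ p q : α × β, p.1 = q.1 → y p = y q) ∧ ∑ p, y p = 0}
  add_mem' := by
    rintro y z ⟨hy, hy0⟩ ⟨hz, hz0⟩
    refine ⟨fun p q h => ?_, ?_⟩
    · simp only [Pi.add_apply, hy p q h, hz p q h]
    · simp only [Pi.add_apply, Finset.sum_add_distrib, hy0, hz0, add_zero]
  zero_mem' := ⟨fun _ _ _ => rfl, by simp⟩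
  smul_mem' := by
    rintro c y ⟨hy, hy0⟩
    refine ⟨fun p q h => ?_, ?_⟩
    · simp only [Pi.smul_apply, hy p q h]
    · simp only [Pi.smul_apply, smul_eq_mul, ← Finset.mul_sum, hy0, mul_zero]

variable (K α β) in
/-- `H` = «`{Σ c_ij y_ij | c_1j + c_2j + c_3j = 0 ∀ j}`»: the vectors all of whose group sums
vanish. [cite: MulmuleySohoniSIAM2001, §8 (AV p.34, all.txt L2594–2640)] -/
def subH : Submodule K (α × β → K) where
  carrier := {y | ∀ i : α, ∑ j : β, y (i, j) = 0}
  add_mem' := by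
    intro y z hy hz i
    simp only [Pi.add_apply, Finset.sum_add_distrib, hy i, hz i, add_zero]
  zero_mem' := fun _ => by simp
  smul_mem' := by
    intro c y hy i
    simp only [Pi.smul_apply, smul_eq_mul, ← Finset.mul_sum, hy i, mul_zero]

omit [Fintype α] [Fintype β] [DecidableEq β] in
/-- Unfolding `groupInd` (`f'_i`). [cite: MulmuleySohoniSIAM2001, §8 (AV p.34, all.txt L2566–2646)] -/
@[simp] theorem groupInd_apply (i : α) (p : α × β) :
    groupInd K β i p = if p.1 = i then 1 else 0 := rfl

omit [Fintype α] in
/-- Unfolding `hVec` (`h'_ij`). [cite: MulmuleySohoniSIAM2001, §8 eq. (14) (AV p.35, all.txt L2700–2708)] -/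
theorem hVec_apply (p q : α × β) :
    hVec K p q = (Fintype.card β : K) * (if q = p then 1 else 0) - (if q.1 = p.1 then 1 else 0) := by
  simp [hVec, Pi.single_apply]

omit [Fintype α] [Fintype β] [DecidableEq α] [DecidableEq β] in
/-- Membership in `E`: the constant vectors («`E` the span of `e'`»). [cite: MulmuleySohoniSIAM2001, §8 (AV p.34, all.txt L2566–2646)] -/
theorem mem_subE_iff {y : α × β → K} : y ∈ subE K α β ↔ ∃ a : K, y = a • (1 : α × β → K) := by
  simp only [subE, Submodule.mem_span_singleton, eq_comm]

omit [Fintype α] [Fintype β] [DecidableEq α] [DecidableEq β] in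
/-- Membership in `E`, pointwise: `y ∈ E ↔ y` is constant. [cite: MulmuleySohoniSIAM2001, §8 (AV p.34, all.txt L2566–2646)] -/
theorem mem_subE_iff_forall_eq {y : α × β → K} : y ∈ subE K α β ↔ ∀ p q : α × β, y p = y q := by
  rw [mem_subE_iff]
  constructor
  · rintro ⟨a, rfl⟩ p q
    simp
  · intro h
    rcases isEmpty_or_nonempty (α × β) with hαβ | ⟨⟨p₀⟩⟩
    · exact ⟨0, funext fun p => (hαβ.false p).elim⟩
    · exact ⟨y p₀, funext fun p => by simpa using h p p₀⟩

omit [DecidableEq α] [DecidableEq β] in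
/-- Membership in `F` («`F = {Σ_r c_r f'_r | Σ_r c_r = 0}`»). [cite: MulmuleySohoniSIAM2001, §8 (AV p.34, all.txt L2566–2646)] -/
theorem mem_subF_iff {y : α × β → K} :
    y ∈ subF K α β ↔ (∀ p q : α × β, p.1 = q.1 → y p = y q) ∧ ∑ p, y p = 0 := Iff.rfl

omit [Fintype α] [DecidableEq α] [DecidableEq β] in
/-- Membership in `H` («`c_1j + c_2j + c_3j = 0 ∀ j`»). [cite: MulmuleySohoniSIAM2001, §8 (AV p.34, all.txt L2566–2646)] -/
theorem mem_subH_iff {y : α × β → K} : y ∈ subH K α β ↔ ∀ i : α, ∑ j : β, y (i, j) = 0 := Iff.rfl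

omit [Fintype α] [Fintype β] [DecidableEq α] [DecidableEq β] in
/-- `e' = 𝟙 ∈ E`. [cite: MulmuleySohoniSIAM2001, §8 (AV p.34, all.txt L2566–2646)] -/
theorem one_mem_subE : (1 : α × β → K) ∈ subE K α β := Submodule.mem_span_singleton_self _

omit [Fintype α] [DecidableEq β] in
/-- The group sums of a group indicator: `Σ_j f'_i (i', j) = k · [i' = i]`. [folklore] -/
private theorem sum_groupInd_apply (i i' : α) :
    ∑ j : β, groupInd K β i (i', j) = if i' = i then (Fintype.card β : K) else 0 := by
  simp only [groupInd_apply]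
  split_ifs <;> simp

omit [DecidableEq β] in
/-- The total of a group indicator is `k`. [folklore] -/
private theorem sum_groupInd (i : α) : ∑ p : α × β, groupInd K β i p = (Fintype.card β : K) := by
  rw [Fintype.sum_prod_type]
  simp only [sum_groupInd_apply, Finset.sum_ite_eq', Finset.mem_univ, if_true]

omit [Fintype α] in
/-- The group sums of a coordinate vector: `Σ_j (c δ_p) (i, j) = c · [i = p.1]`. [folklore] -/
private theorem sum_single_apply_mk (p : α × β) (c : K) (i : α) :
    ∑ j, (Pi.single p c : α × β → K) (i, j) = if i = p.1 then c else 0 := by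
  simp only [Pi.single_apply, Prod.ext_iff]
  by_cases hi : i = p.1
  · simp [hi]
  · simp [hi]

omit [DecidableEq β] in
/-- `f'_i − f'_{i'} ∈ F`. [cite: MulmuleySohoniSIAM2001, §8 (AV p.34, all.txt L2566–2569)] -/
theorem groupInd_sub_groupInd_mem_subF (i i' : α) :
    groupInd K β i - groupInd K β i' ∈ subF K α β := by
  refine ⟨fun p q h => by simp [h], ?_⟩
  simp only [Pi.sub_apply, Finset.sum_sub_distrib, sum_groupInd, sub_self]

omit [Fintype α] in
/-- `y_(i,j) − y_(i,j') ∈ H` (two points of the same group). [cite: MulmuleySohoniSIAM2001, §8 (AV p.34, all.txt L2566–2646)] -/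
theorem single_sub_single_mem_subH {p q : α × β} (h : p.1 = q.1) :
    (Pi.single p 1 : α × β → K) - Pi.single q 1 ∈ subH K α β := by
  intro i
  simp only [Pi.sub_apply, Finset.sum_sub_distrib, sum_single_apply_mk, h, sub_self]

omit [Fintype α] in
/-- `h'_ij ∈ H`. [cite: MulmuleySohoniSIAM2001, §8 (AV p.35, all.txt L2700–2702)] -/
theorem hVec_mem_subH (p : α × β) : hVec K p ∈ subH K α β := by
  intro i
  simp only [hVec, Pi.sub_apply, Pi.smul_apply, smul_eq_mul, Finset.sum_sub_distrib,
    ← Finset.mul_sum, sum_single_apply_mk, sum_groupInd_apply]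
  split_ifs <;> simp

/-! ### The action `y ↦ y ∘ w` and `D`-stability -/

omit [Fintype α] [Fintype β] in
/-- A coordinate vector moves to a coordinate vector: `δ_p ∘ w = δ_{w⁻¹ p}` («`D` acts on `Y`
naturally, viz., `β(y_ij) = y_{β(i,j)}`»). [cite: MulmuleySohoniSIAM2001, §8 (AV p.34, all.txt L2560–2564)] -/
theorem single_comp_equiv (w : Equiv.Perm (α × β)) (p : α × β) (c : K) :
    (Pi.single p c : α × β → K) ∘ w = Pi.single (w.symm p) c := by
  funext q
  simp only [Function.comp_apply, Pi.single_apply, Equiv.apply_eq_iff_eq_symm_apply]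

omit [Fintype α] [Fintype β] [DecidableEq β] in
/-- A group indicator moves to a group indicator: `f'_i ∘ (κ; π) = f'_{κ⁻¹ i}`. [cite: MulmuleySohoniSIAM2001, §8 (AV p.34, all.txt L2560–2564)] -/
theorem groupInd_comp_prodShear (κ : Equiv.Perm α) (π : α → Equiv.Perm β) (i : α) :
    groupInd K β i ∘ Equiv.prodShear κ π = groupInd K β (κ.symm i) := by
  funext q
  simp only [Function.comp_apply, groupInd_apply, Equiv.prodShear_apply,
    Equiv.apply_eq_iff_eq_symm_apply]

/-- **`D`-stability of a subspace of `Y`**: `U ∘ w ⊆ U` for every `w = (κ; π) ∈ D`.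
[cite: MulmuleySohoniSIAM2001, §8 (AV p.34, all.txt L2560–2570)] -/
def IsWreathStable (U : Submodule K (α × β → K)) : Prop :=
  ∀ (κ : Equiv.Perm α) (π : α → Equiv.Perm β), ∀ y ∈ U, y ∘ Equiv.prodShear κ π ∈ U

omit [Fintype α] [Fintype β] [DecidableEq α] [DecidableEq β] in
/-- `D`-stability in terms of the subgroup `wreathProduct`. [cite: MulmuleySohoniSIAM2001, §8 (AV p.34, all.txt L2560–2564)] -/
theorem isWreathStable_iff (U : Submodule K (α × β → K)) :
    IsWreathStable U ↔ ∀ w ∈ wreathProduct α β, ∀ y ∈ U, y ∘ w ∈ U := by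
  constructor
  · rintro h w ⟨κ, π, rfl⟩
    exact h κ π
  · intro h κ π
    exact h _ (prodShear_mem_wreathProduct κ π)

omit [Fintype α] [Fintype β] [DecidableEq α] [DecidableEq β] in
/-- A `D`-stable subspace is also stable under `y ↦ y ∘ w⁻¹` (MS's left action
`β(y_ij) = y_{β(i,j)}`). [cite: MulmuleySohoniSIAM2001, §8 (AV p.34, all.txt L2560–2564)] -/
theorem IsWreathStable.comp_symm_mem {U : Submodule K (α × β → K)} (hU : IsWreathStable U)
    (κ : Equiv.Perm α) (π : α → Equiv.Perm β) {y : α × β → K} (hy : y ∈ U) :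
    y ∘ (Equiv.prodShear κ π).symm ∈ U := by
  have h := hU κ⁻¹ (fun i => (π (κ⁻¹ i))⁻¹) y hy
  rwa [← prodShear_inv] at h

omit [Fintype α] [Fintype β] [DecidableEq α] [DecidableEq β] in
/-- `⊥` is `D`-stable (plumbing for the sums of `E`, `F`, `H`). [cite: MulmuleySohoniSIAM2001, §8 (AV p.34, all.txt L2642–2646)] -/
theorem isWreathStable_bot : IsWreathStable (⊥ : Submodule K (α × β → K)) := by
  intro κ π y hy
  rw [Submodule.mem_bot] at hy ⊢
  subst hy
  rfl

omit [Fintype α] [Fintype β] [DecidableEq α] [DecidableEq β] in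
/-- `⊤ = Y` is `D`-stable. [cite: MulmuleySohoniSIAM2001, §8 (AV p.34, all.txt L2642–2646)] -/
theorem isWreathStable_top : IsWreathStable (⊤ : Submodule K (α × β → K)) :=
  fun _ _ _ _ => Submodule.mem_top

omit [Fintype α] [Fintype β] [DecidableEq α] [DecidableEq β] in
/-- Sums of `D`-stable subspaces are `D`-stable (so are the eight sums of `E`, `F`, `H`). [cite: MulmuleySohoniSIAM2001, §8 (AV p.34, all.txt L2642–2646)] -/
theorem IsWreathStable.sup {U V : Submodule K (α × β → K)} (hU : IsWreathStable U)
    (hV : IsWreathStable V) : IsWreathStable (U ⊔ V) := by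
  intro κ π y hy
  obtain ⟨u, hu, v, hv, rfl⟩ := Submodule.mem_sup.mp hy
  have : (u + v) ∘ Equiv.prodShear κ π = u ∘ Equiv.prodShear κ π + v ∘ Equiv.prodShear κ π := rfl
  rw [this]
  exact Submodule.add_mem_sup (hU κ π u hu) (hV κ π v hv)

omit [Fintype α] [Fintype β] [DecidableEq α] [DecidableEq β] in
/-- Intersections of `D`-stable subspaces are `D`-stable. [cite: MulmuleySohoniSIAM2001, §8 (AV p.34, all.txt L2642–2646)] -/
theorem IsWreathStable.inf {U V : Submodule K (α × β → K)} (hU : IsWreathStable U)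
    (hV : IsWreathStable V) : IsWreathStable (U ⊓ V) :=
  fun κ π _ hy => ⟨hU κ π _ hy.1, hV κ π _ hy.2⟩

omit [Fintype α] [Fintype β] [DecidableEq α] [DecidableEq β] in
/-- **`E` is `D`-stable** («It is clear that `E`, `F` are invariant under the action of `D`»).
[cite: MulmuleySohoniSIAM2001, §8 (AV p.34, all.txt L2568–2570)] -/
theorem isWreathStable_subE : IsWreathStable (subE K α β) := by
  intro κ π y hy
  obtain ⟨a, rfl⟩ := mem_subE_iff.mp hy
  exact mem_subE_iff.mpr ⟨a, rfl⟩

omit [DecidableEq α] [DecidableEq β] in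
/-- **`F` is `D`-stable.** [cite: MulmuleySohoniSIAM2001, §8 (AV p.34, all.txt L2568–2570)] -/
theorem isWreathStable_subF : IsWreathStable (subF K α β) := by
  intro κ π y hy
  obtain ⟨hc, h0⟩ := hy
  refine ⟨fun p q h => hc _ _ (by simpa [Equiv.prodShear_apply] using congrArg κ h), ?_⟩
  rw [show ∑ p, (y ∘ Equiv.prodShear κ π) p = ∑ p, y p from
    Fintype.sum_equiv (Equiv.prodShear κ π) _ _ fun _ => rfl, h0]

omit [Fintype α] [DecidableEq α] [DecidableEq β] in
/-- **`H` is `D`-stable.** [cite: MulmuleySohoniSIAM2001, §8 (AV p.34, all.txt L2640–2642)] -/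
theorem isWreathStable_subH : IsWreathStable (subH K α β) := by
  intro κ π y hy i
  have : ∑ j, (y ∘ Equiv.prodShear κ π) (i, j) = ∑ j, y (κ i, j) :=
    Fintype.sum_equiv (π i) _ _ fun _ => rfl
  rw [this]
  exact hy (κ i)

omit [Fintype α] [Fintype β] in
/-- **The `D`-fixed vectors of `Y` are the constants: `Y^D = E`** (irreducibility of the trivial
summand; «Irreducibility of `E` is clear»). [cite: MulmuleySohoniSIAM2001, §8 (AV p.34, all.txt L2570)] -/
theorem forall_comp_prodShear_eq_iff {y : α × β → K} :
    (∀ (κ : Equiv.Perm α) (π : α → Equiv.Perm β), y ∘ Equiv.prodShear κ π = y) ↔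
      y ∈ subE K α β := by
  rw [mem_subE_iff_forall_eq]
  constructor
  · intro h p q
    obtain ⟨κ, π, hw⟩ := exists_prodShear_apply_eq p q
    have := congrFun (h κ π) p
    rw [Function.comp_apply, hw] at this
    exact this.symm
  · intro h κ π
    funext p
    exact h _ _

end Module

/-! ## § 3. Eq. (14), the projections onto `E`, `F`, `H`, and `Y = E ⊕ F ⊕ H` -/

section Decomposition

omit [DecidableEq β] in
/-- **MS eq. (17), the «unprimed» (vector) form of eq. (14), in any `K`-module `V`**: for a family
`x_(i,j) ∈ V` put `e = Σ x`, `f_i = Σ_j x_(i,j)`, `h_(i,j) = k·x_(i,j) − f_i`; then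
`k m · x_(i,j) = e + Σ_{i' ≠ i} (f_i − f_{i'}) + m · h_(i,j)` («`3m·X[i;j] = e + Σ_{r≠i}(f_i − f_r)
+ m·h_ij` (17)»). [cite: MulmuleySohoniSIAM2001, §8 eq. (17) (AV p.35, all.txt L2770–2776)] -/
theorem card_mul_card_smul_apply_eq {V : Type*} [AddCommGroup V] [Module K V] (x : α × β → V)
    (p : α × β) :
    ((Fintype.card β : K) * (Fintype.card α : K)) • x p =
      (∑ q, x q) + (∑ i ∈ Finset.univ.erase p.1, ((∑ j, x (p.1, j)) - ∑ j, x (i, j))) +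
        (Fintype.card α : K) • ((Fintype.card β : K) • x p - ∑ j, x (p.1, j)) := by
  have h1 : ∑ i ∈ Finset.univ.erase p.1, ((∑ j, x (p.1, j)) - ∑ j, x (i, j)) =
      (Fintype.card α : K) • (∑ j, x (p.1, j)) - ∑ q, x q := by
    rw [Finset.sum_sub_distrib, Finset.sum_const, Finset.card_erase_of_mem (Finset.mem_univ _),
      Finset.card_univ, Finset.sum_erase_eq_sub (Finset.mem_univ _), Fintype.sum_prod_type x]
    have hc : 1 ≤ Fintype.card α := Fintype.card_pos_iff.mpr ⟨p.1⟩
    rw [← Nat.cast_smul_eq_nsmul K, Nat.cast_sub hc, Nat.cast_one, sub_smul, one_smul]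
    abel
  rw [h1, smul_sub, mul_comm, mul_smul]
  abel

/-- **MS eq. (14)**: `k m · δ_p = e' + Σ_{i' ≠ i} (f'_i − f'_{i'}) + m · h'_p` for `p = (i, j)`,
`i` the GROUP of `p` («We may check that `3m·y_ij = e' + Σ_{r : r ≠ i} (f'_i − f'_r) + m·h'_ij`
(14)»; general `k`). Reading note: with MS's own definitions `f'_j = y_1j + y_2j + y_3j` (indexed
by the group `j` of `y_ij`) the summand must be read `f'_j − f'_r`, `r ≠ j` — the printed `f'_i`,
`r ≠ i` interchanges the two indices of `y_ij`; the identity holds (only) in the group-indexed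
reading, which is the one formalised. [cite: MulmuleySohoniSIAM2001, §8 eq. (14) (AV p.35, all.txt L2702–2708)] -/
theorem card_mul_card_smul_single_eq (p : α × β) :
    ((Fintype.card β : K) * (Fintype.card α : K)) • (Pi.single p 1 : α × β → K) =
      1 + (∑ i ∈ Finset.univ.erase p.1, (groupInd K β p.1 - groupInd K β i)) +
        (Fintype.card α : K) • hVec K p := by
  have h := card_mul_card_smul_apply_eq (K := K) (fun q : α × β => (Pi.single q (1 : K) : α × β → K)) p
  have hsum : ∑ q : α × β, (Pi.single q (1 : K) : α × β → K) = 1 :=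
    Finset.univ_sum_single (1 : α × β → K)
  have hgrp : ∀ i : α, ∑ j, (Pi.single (i, j) (1 : K) : α × β → K) = groupInd K β i := by
    intro i
    funext q
    simp only [Finset.sum_apply, Pi.single_apply, groupInd_apply, Prod.ext_iff]
    by_cases hq : q.1 = i
    · simp [hq]
    · simp [hq]
  simp only [hsum, hgrp] at h
  rw [hVec]
  exact h

variable (K α β) in
/-- The group sums `y ↦ (i ↦ Σ_j y_(i,j))` (the `f_i`-coefficients; MS: «`c_1j + c_2j + c_3j`»).
[cite: MulmuleySohoniSIAM2001, §8 (AV p.34, all.txt L2566–2646)] -/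
def groupSum : (α × β → K) →ₗ[K] (α → K) where
  toFun y i := ∑ j, y (i, j)
  map_add' y z := by
    funext i
    simp [Finset.sum_add_distrib]
  map_smul' c y := by
    funext i
    simp [Finset.mul_sum]

variable (K α β) in
/-- The `D`-equivariant projection onto `E` along `F ⊕ H`: `y ↦ (mean of y) · 𝟙` (the `e'`-component
of eq. (14)). [cite: MulmuleySohoniSIAM2001, §8 eq. (14) (AV p.35)] -/
def projE : (α × β → K) →ₗ[K] (α × β → K) where
  toFun y := fun _ => (Fintype.card α : K)⁻¹ * (Fintype.card β : K)⁻¹ * ∑ q, y q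
  map_add' y z := by
    funext q
    simp only [Pi.add_apply, Finset.sum_add_distrib]
    ring
  map_smul' c y := by
    funext q
    simp only [Pi.smul_apply, smul_eq_mul, RingHom.id_apply, ← Finset.mul_sum]
    ring

variable (K α β) in
/-- The `D`-equivariant projection onto `F` along `E ⊕ H`: `y ↦ (group means of y) − (mean of y)`
(the `Σ_{r≠i}(f'_i − f'_r)`-component of eq. (14)). [cite: MulmuleySohoniSIAM2001, §8 eq. (14) (AV p.35)] -/
def projF : (α × β → K) →ₗ[K] (α × β → K) where
  toFun y := fun p => (Fintype.card β : K)⁻¹ * (∑ j, y (p.1, j)) -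
    (Fintype.card α : K)⁻¹ * (Fintype.card β : K)⁻¹ * ∑ q, y q
  map_add' y z := by
    funext q
    simp only [Pi.add_apply, Finset.sum_add_distrib]
    ring
  map_smul' c y := by
    funext q
    simp only [Pi.smul_apply, smul_eq_mul, RingHom.id_apply, ← Finset.mul_sum]
    ring

variable (K α β) in
/-- The `D`-equivariant projection onto `H` along `E ⊕ F`: `y ↦ y − (group means of y)` (the
`h'_ij`-component of eq. (14)). [cite: MulmuleySohoniSIAM2001, §8 eq. (14) (AV p.35)] -/
def projH : (α × β → K) →ₗ[K] (α × β → K) where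
  toFun y := fun p => y p - (Fintype.card β : K)⁻¹ * ∑ j, y (p.1, j)
  map_add' y z := by
    funext q
    simp only [Pi.add_apply, Finset.sum_add_distrib]
    ring
  map_smul' c y := by
    funext q
    simp only [Pi.smul_apply, smul_eq_mul, RingHom.id_apply, ← Finset.mul_sum]
    ring

omit [Fintype α] [DecidableEq α] [DecidableEq β] in
/-- Unfolding `groupSum`. [cite: MulmuleySohoniSIAM2001, §8 (AV p.34, all.txt L2566–2646)] -/
@[simp] theorem groupSum_apply (y : α × β → K) (i : α) : groupSum K α β y i = ∑ j, y (i, j) := rfl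

omit [DecidableEq α] [DecidableEq β] in
/-- Unfolding `projE`. [cite: MulmuleySohoniSIAM2001, §8 eq. (14) (AV p.35, all.txt L2700–2708)] -/
@[simp] theorem projE_apply (y : α × β → K) (p : α × β) :
    projE K α β y p = (Fintype.card α : K)⁻¹ * (Fintype.card β : K)⁻¹ * ∑ q, y q := rfl

omit [DecidableEq α] [DecidableEq β] in
/-- Unfolding `projF`. [cite: MulmuleySohoniSIAM2001, §8 eq. (14) (AV p.35, all.txt L2700–2708)] -/
@[simp] theorem projF_apply (y : α × β → K) (p : α × β) :
    projF K α β y p = (Fintype.card β : K)⁻¹ * (∑ j, y (p.1, j)) -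
      (Fintype.card α : K)⁻¹ * (Fintype.card β : K)⁻¹ * ∑ q, y q := rfl

omit [Fintype α] [DecidableEq α] [DecidableEq β] in
/-- Unfolding `projH`. [cite: MulmuleySohoniSIAM2001, §8 eq. (14) (AV p.35, all.txt L2700–2708)] -/
@[simp] theorem projH_apply (y : α × β → K) (p : α × β) :
    projH K α β y p = y p - (Fintype.card β : K)⁻¹ * ∑ j, y (p.1, j) := rfl

omit [DecidableEq α] [DecidableEq β] in
/-- **Eq. (14) in operator form: `projE + projF + projH = id`** (valid over every field, with the
convention `0⁻¹ = 0`). [cite: MulmuleySohoniSIAM2001, §8 eq. (14) (AV p.35)] -/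
theorem projE_add_projF_add_projH (y : α × β → K) :
    projE K α β y + projF K α β y + projH K α β y = y := by
  funext p
  simp only [Pi.add_apply, projE_apply, projF_apply, projH_apply]
  ring

omit [DecidableEq α] [DecidableEq β] in
/-- The sum of the group sums is the total. [folklore] -/
private theorem sum_groupSum (y : α × β → K) : ∑ i, ∑ j, y (i, j) = ∑ q, y q :=
  (Fintype.sum_prod_type y).symm

omit [DecidableEq α] [DecidableEq β] in
/-- `projE y ∈ E`. [cite: MulmuleySohoniSIAM2001, §8 eq. (14) (AV p.35, all.txt L2700–2708)] -/
theorem projE_mem_subE (y : α × β → K) : projE K α β y ∈ subE K α β :=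
  mem_subE_iff.mpr ⟨(Fintype.card α : K)⁻¹ * (Fintype.card β : K)⁻¹ * ∑ q, y q, by
    funext p
    simp⟩

omit [DecidableEq α] [DecidableEq β] in
/-- `projF y ∈ F` (when `k, m ≠ 0` in `K`). [cite: MulmuleySohoniSIAM2001, §8 eq. (14) (AV p.35, all.txt L2700–2708)] -/
theorem projF_mem_subF (hα : (Fintype.card α : K) ≠ 0) (hβ : (Fintype.card β : K) ≠ 0)
    (y : α × β → K) : projF K α β y ∈ subF K α β := by
  refine ⟨fun p q h => by simp only [projF_apply, h], ?_⟩
  have hS : ∑ p : α × β, ∑ j, y (p.1, j) = (Fintype.card β : K) * ∑ q, y q := by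
    rw [Fintype.sum_prod_type, ← sum_groupSum y, Finset.mul_sum]
    refine Finset.sum_congr rfl fun i _ => ?_
    simp
  simp only [projF_apply, Finset.sum_sub_distrib, ← Finset.mul_sum, hS, Finset.sum_const,
    Finset.card_univ, nsmul_eq_mul, Fintype.card_prod, Nat.cast_mul]
  field_simp
  ring

omit [Fintype α] [DecidableEq α] [DecidableEq β] in
/-- `projH y ∈ H` (when `k ≠ 0` in `K`; MS: «note that `h'_ij ∈ H`»). [cite: MulmuleySohoniSIAM2001, §8 eq. (14) (AV p.35, all.txt L2700–2708)] -/
theorem projH_mem_subH (hβ : (Fintype.card β : K) ≠ 0) (y : α × β → K) :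
    projH K α β y ∈ subH K α β := by
  intro i
  simp only [projH_apply, Finset.sum_sub_distrib, Finset.sum_const, Finset.card_univ,
    nsmul_eq_mul]
  rw [mul_inv_cancel_left₀ hβ, sub_self]

omit [Fintype α] [DecidableEq α] [DecidableEq β] in
/-- `projH` is the identity on `H`. [cite: MulmuleySohoniSIAM2001, §8 (AV p.34, all.txt L2642–2646)] -/
theorem projH_eq_self_of_mem_subH {y : α × β → K} (hy : y ∈ subH K α β) : projH K α β y = y := by
  funext p
  simp [projH_apply, hy p.1]

omit [Fintype α] [DecidableEq α] [DecidableEq β] in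
/-- `projH` kills the group-constant vectors (so `E` and `F`), when `k ≠ 0` in `K`. [cite: MulmuleySohoniSIAM2001, §8 (AV p.34, all.txt L2642–2646)] -/
theorem projH_eq_zero_of_forall_eq (hβ : (Fintype.card β : K) ≠ 0) {y : α × β → K}
    (hy : ∀ p q : α × β, p.1 = q.1 → y p = y q) : projH K α β y = 0 := by
  funext p
  rw [projH_apply, Finset.sum_congr rfl fun j _ => hy (p.1, j) p rfl, Finset.sum_const,
    Finset.card_univ, nsmul_eq_mul, inv_mul_cancel_left₀ hβ, sub_self, Pi.zero_apply]

omit [Fintype α] [DecidableEq α] [DecidableEq β] in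
/-- `projH` vanishes on `E` (when `k ≠ 0` in `K`). [cite: MulmuleySohoniSIAM2001, §8 (AV p.34, all.txt L2642–2646)] -/
theorem projH_eq_zero_of_mem_subE (hβ : (Fintype.card β : K) ≠ 0) {y : α × β → K}
    (hy : y ∈ subE K α β) : projH K α β y = 0 :=
  projH_eq_zero_of_forall_eq hβ fun p q _ => mem_subE_iff_forall_eq.mp hy p q

omit [DecidableEq α] [DecidableEq β] in
/-- `projH` vanishes on `F` (when `k ≠ 0` in `K`). [cite: MulmuleySohoniSIAM2001, §8 (AV p.34, all.txt L2642–2646)] -/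
theorem projH_eq_zero_of_mem_subF (hβ : (Fintype.card β : K) ≠ 0) {y : α × β → K}
    (hy : y ∈ subF K α β) : projH K α β y = 0 :=
  projH_eq_zero_of_forall_eq hβ hy.1

omit [DecidableEq α] [DecidableEq β] in
/-- `projF` vanishes on `H`. [cite: MulmuleySohoniSIAM2001, §8 (AV p.34, all.txt L2642–2646)] -/
theorem projF_eq_zero_of_mem_subH {y : α × β → K} (hy : y ∈ subH K α β) : projF K α β y = 0 := by
  funext p
  rw [projF_apply, ← sum_groupSum y, Finset.sum_eq_zero fun i _ => hy i, hy p.1]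
  simp

omit [DecidableEq α] [DecidableEq β] in
/-- `projF` vanishes on `E` (when `k, m ≠ 0` in `K`). [cite: MulmuleySohoniSIAM2001, §8 (AV p.34, all.txt L2642–2646)] -/
theorem projF_eq_zero_of_mem_subE (hα : (Fintype.card α : K) ≠ 0) (hβ : (Fintype.card β : K) ≠ 0)
    {y : α × β → K} (hy : y ∈ subE K α β) : projF K α β y = 0 := by
  obtain ⟨a, rfl⟩ := mem_subE_iff.mp hy
  funext p
  simp only [projF_apply, Pi.smul_apply, Pi.one_apply, smul_eq_mul, mul_one, Finset.sum_const,
    Finset.card_univ, nsmul_eq_mul, Fintype.card_prod, Nat.cast_mul, Pi.zero_apply]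
  field_simp
  ring

omit [DecidableEq α] [DecidableEq β] in
/-- `projF` is the identity on `F` (when `k ≠ 0` in `K`). [cite: MulmuleySohoniSIAM2001, §8 (AV p.34, all.txt L2642–2646)] -/
theorem projF_eq_self_of_mem_subF (hβ : (Fintype.card β : K) ≠ 0) {y : α × β → K}
    (hy : y ∈ subF K α β) : projF K α β y = y := by
  funext p
  rw [projF_apply, hy.2, Finset.sum_congr rfl fun j _ => hy.1 (p.1, j) p rfl, Finset.sum_const,
    Finset.card_univ, nsmul_eq_mul, inv_mul_cancel_left₀ hβ]
  simp

omit [DecidableEq α] [DecidableEq β] in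
/-- `projE` vanishes on `F`. [cite: MulmuleySohoniSIAM2001, §8 (AV p.34, all.txt L2642–2646)] -/
theorem projE_eq_zero_of_mem_subF {y : α × β → K} (hy : y ∈ subF K α β) : projE K α β y = 0 := by
  funext p
  simp [projE_apply, hy.2]

omit [DecidableEq α] [DecidableEq β] in
/-- `projE` vanishes on `H`. [cite: MulmuleySohoniSIAM2001, §8 (AV p.34, all.txt L2642–2646)] -/
theorem projE_eq_zero_of_mem_subH {y : α × β → K} (hy : y ∈ subH K α β) : projE K α β y = 0 := by
  funext p
  rw [projE_apply, ← sum_groupSum y, Finset.sum_eq_zero fun i _ => hy i]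
  simp

omit [DecidableEq α] [DecidableEq β] in
/-- `projE` is the identity on `E` (when `k, m ≠ 0` in `K`). [cite: MulmuleySohoniSIAM2001, §8 (AV p.34, all.txt L2642–2646)] -/
theorem projE_eq_self_of_mem_subE (hα : (Fintype.card α : K) ≠ 0) (hβ : (Fintype.card β : K) ≠ 0)
    {y : α × β → K} (hy : y ∈ subE K α β) : projE K α β y = y := by
  obtain ⟨a, rfl⟩ := mem_subE_iff.mp hy
  funext p
  simp only [projE_apply, Pi.smul_apply, Pi.one_apply, smul_eq_mul, mul_one, Finset.sum_const,
    Finset.card_univ, nsmul_eq_mul, Fintype.card_prod, Nat.cast_mul]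
  field_simp

omit [Fintype α] [DecidableEq α] [DecidableEq β] in
/-- The projections are `D`-EQUIVARIANT: `projH (y ∘ w) = projH y ∘ w` («splits … as `D`-modules»).
[cite: MulmuleySohoniSIAM2001, §8 (AV p.34, all.txt L2642–2646)] -/
theorem projH_comp_prodShear (κ : Equiv.Perm α) (π : α → Equiv.Perm β) (y : α × β → K) :
    projH K α β (y ∘ Equiv.prodShear κ π) = projH K α β y ∘ Equiv.prodShear κ π := by
  funext p
  simp only [projH_apply, Function.comp_apply, Equiv.prodShear_apply]
  rw [show ∑ j, y (κ p.1, π p.1 j) = ∑ j, y (κ p.1, j) from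
    Fintype.sum_equiv (π p.1) _ _ fun _ => rfl]

omit [DecidableEq α] [DecidableEq β] in
/-- `projF (y ∘ w) = projF y ∘ w`. [cite: MulmuleySohoniSIAM2001, §8 (AV p.34, all.txt L2642–2646)] -/
theorem projF_comp_prodShear (κ : Equiv.Perm α) (π : α → Equiv.Perm β) (y : α × β → K) :
    projF K α β (y ∘ Equiv.prodShear κ π) = projF K α β y ∘ Equiv.prodShear κ π := by
  funext p
  simp only [projF_apply, Function.comp_apply, Equiv.prodShear_apply]
  rw [show ∑ j, y (κ p.1, π p.1 j) = ∑ j, y (κ p.1, j) from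
    Fintype.sum_equiv (π p.1) _ _ fun _ => rfl,
    show ∑ q : α × β, y (κ q.1, π q.1 q.2) = ∑ q, y q from
    Fintype.sum_equiv (Equiv.prodShear κ π) _ _ fun _ => rfl]

omit [DecidableEq α] [DecidableEq β] in
/-- `projE (y ∘ w) = projE y ∘ w`. [cite: MulmuleySohoniSIAM2001, §8 (AV p.34, all.txt L2642–2646)] -/
theorem projE_comp_prodShear (κ : Equiv.Perm α) (π : α → Equiv.Perm β) (y : α × β → K) :
    projE K α β (y ∘ Equiv.prodShear κ π) = projE K α β y ∘ Equiv.prodShear κ π := by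
  funext p
  simp only [projE_apply, Function.comp_apply, Equiv.prodShear_apply]
  rw [show ∑ q : α × β, y (κ q.1, π q.1 q.2) = ∑ q, y q from
    Fintype.sum_equiv (Equiv.prodShear κ π) _ _ fun _ => rfl]

omit [DecidableEq α] [DecidableEq β] in
/-- **`Y = E + F + H`** (when `k, m ≠ 0` in `K`; «the `D`-module `Y` splits … `Y = E ⊕ F ⊕ H`»).
[cite: MulmuleySohoniSIAM2001, §8 (AV p.34, all.txt L2642–2646)] -/
theorem subE_sup_subF_sup_subH_eq_top (hα : (Fintype.card α : K) ≠ 0) (hβ : (Fintype.card β : K) ≠ 0) :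
    subE K α β ⊔ subF K α β ⊔ subH K α β = ⊤ := by
  refine eq_top_iff.mpr fun y _ => ?_
  rw [← projE_add_projF_add_projH y]
  exact Submodule.add_mem_sup
    (Submodule.add_mem_sup (projE_mem_subE y) (projF_mem_subF hα hβ y)) (projH_mem_subH hβ y)

omit [DecidableEq α] [DecidableEq β] in
/-- `E ∩ F = 0` (when `k, m ≠ 0` in `K`). [cite: MulmuleySohoniSIAM2001, §8 (AV p.34, all.txt L2642–2646)] -/
theorem subE_inf_subF_eq_bot (hα : (Fintype.card α : K) ≠ 0) (hβ : (Fintype.card β : K) ≠ 0) :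
    subE K α β ⊓ subF K α β = ⊥ := by
  refine (Submodule.eq_bot_iff _).mpr fun y hy => ?_
  rw [← projE_eq_self_of_mem_subE hα hβ hy.1]
  exact projE_eq_zero_of_mem_subF hy.2

omit [DecidableEq α] [DecidableEq β] in
/-- `(E + F) ∩ H = 0` (when `k ≠ 0` in `K`). [cite: MulmuleySohoniSIAM2001, §8 (AV p.34, all.txt L2642–2646)] -/
theorem subE_sup_subF_inf_subH_eq_bot (hβ : (Fintype.card β : K) ≠ 0) :
    (subE K α β ⊔ subF K α β) ⊓ subH K α β = ⊥ := by
  refine (Submodule.eq_bot_iff _).mpr fun y hy => ?_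
  obtain ⟨e, he, f, hf, rfl⟩ := Submodule.mem_sup.mp hy.1
  rw [← projH_eq_self_of_mem_subH hy.2, map_add, projH_eq_zero_of_mem_subE hβ he,
    projH_eq_zero_of_mem_subF hβ hf, add_zero]

omit [DecidableEq α] [DecidableEq β] in
/-- `E ∩ H = 0` (when `k ≠ 0` in `K`). [cite: MulmuleySohoniSIAM2001, §8 (AV p.34, all.txt L2642–2646)] -/
theorem subE_inf_subH_eq_bot (hβ : (Fintype.card β : K) ≠ 0) : subE K α β ⊓ subH K α β = ⊥ :=
  eq_bot_iff.mpr (le_trans (inf_le_inf_right _ le_sup_left)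
    (subE_sup_subF_inf_subH_eq_bot (K := K) (α := α) (β := β) hβ).le)

omit [DecidableEq α] [DecidableEq β] in
/-- `F ∩ H = 0` (when `k ≠ 0` in `K`). [cite: MulmuleySohoniSIAM2001, §8 (AV p.34, all.txt L2642–2646)] -/
theorem subF_inf_subH_eq_bot (hβ : (Fintype.card β : K) ≠ 0) : subF K α β ⊓ subH K α β = ⊥ :=
  eq_bot_iff.mpr (le_trans (inf_le_inf_right _ le_sup_right)
    (subE_sup_subF_inf_subH_eq_bot (K := K) (α := α) (β := β) hβ).le)

/-! ### Dimensions -/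

omit [Fintype α] [Fintype β] [DecidableEq α] [DecidableEq β] in
/-- `dim E = 1` (for `α × β` nonempty). [cite: MulmuleySohoniSIAM2001, §8 (AV p.35, all.txt L2721)] -/
theorem finrank_subE [Nonempty (α × β)] : Module.finrank K (subE K α β) = 1 :=
  finrank_span_singleton one_ne_zero

omit [Fintype α] [DecidableEq α] [DecidableEq β] in
/-- `H` is the kernel of the group-sum map. [folklore] -/
private theorem subH_eq_ker_groupSum : subH K α β = LinearMap.ker (groupSum K α β) := by
  ext y
  simp only [mem_subH_iff, LinearMap.mem_ker, funext_iff, groupSum_apply, Pi.zero_apply]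

omit [Fintype α] [DecidableEq α] in
/-- The group-sum map is onto (for `β` nonempty). [folklore] -/
private theorem groupSum_surjective [Nonempty β] : Function.Surjective (groupSum K α β) := by
  intro c
  obtain ⟨j₀⟩ := ‹Nonempty β›
  refine ⟨fun p => if p.2 = j₀ then c p.1 else 0, funext fun i => ?_⟩
  simp [groupSum_apply, Finset.sum_ite_eq']

omit [DecidableEq α] [DecidableEq β] in
/-- **`dim H = m (k − 1)`** (MS at `k = 3`: «`dim(H) = 2m`»; no hypothesis on `K`).
[cite: MulmuleySohoniSIAM2001, §8 (AV p.35, all.txt L2721)] -/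
theorem finrank_subH :
    Module.finrank K (subH K α β) = Fintype.card α * (Fintype.card β - 1) := by
  classical
  rcases isEmpty_or_nonempty β with hβ | hβ
  · have : Fintype.card β = 0 := Fintype.card_eq_zero
    rw [this, Nat.zero_sub, mul_zero]
    haveI : Subsingleton (α × β → K) := inferInstance
    rw [Submodule.eq_bot_of_subsingleton (p := subH K α β), finrank_bot]
  · have hrn := LinearMap.finrank_range_add_finrank_ker (groupSum K α β)
    rw [LinearMap.range_eq_top.mpr groupSum_surjective, finrank_top,
      Module.finrank_fintype_fun_eq_card, Module.finrank_fintype_fun_eq_card, Fintype.card_prod,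
      ← subH_eq_ker_groupSum] at hrn
    rw [Nat.mul_sub_one]
    omega

omit [DecidableEq α] [DecidableEq β] in
/-- **`dim F = m − 1`** (when `k, m ≠ 0` in `K`; «`dim(F) = m − 1`»).
[cite: MulmuleySohoniSIAM2001, §8 (AV p.35, all.txt L2721)] -/
theorem finrank_subF (hα : (Fintype.card α : K) ≠ 0) (hβ : (Fintype.card β : K) ≠ 0) :
    Module.finrank K (subF K α β) = Fintype.card α - 1 := by
  have hαpos : 0 < Fintype.card α := Nat.pos_of_ne_zero fun h => hα (by rw [h, Nat.cast_zero])
  have hβpos : 0 < Fintype.card β := Nat.pos_of_ne_zero fun h => hβ (by rw [h, Nat.cast_zero])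
  haveI : Nonempty α := Fintype.card_pos_iff.mp hαpos
  haveI : Nonempty β := Fintype.card_pos_iff.mp hβpos
  have h1 := Submodule.finrank_sup_add_finrank_inf_eq (subE K α β) (subF K α β)
  rw [subE_inf_subF_eq_bot hα hβ, finrank_bot, add_zero, finrank_subE] at h1
  have h2 := Submodule.finrank_sup_add_finrank_inf_eq (subE K α β ⊔ subF K α β) (subH K α β)
  rw [subE_sup_subF_inf_subH_eq_bot hβ, finrank_bot, add_zero, subE_sup_subF_sup_subH_eq_top hα hβ,
    finrank_top, Module.finrank_fintype_fun_eq_card, Fintype.card_prod, h1, finrank_subH] at h2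
  obtain ⟨n, hn⟩ : ∃ n, Fintype.card α * Fintype.card β = n := ⟨_, rfl⟩
  have h3 : Fintype.card α * (Fintype.card β - 1) = n - Fintype.card α := by
    rw [Nat.mul_sub_one, hn]
  have h4 : Fintype.card α ≤ n := hn ▸ Nat.le_mul_of_pos_right _ hβpos
  rw [hn, h3] at h2
  omega

end Decomposition

/-! ## § 4. Multiplicity-freeness -/

section Commutant

variable {f : (α × β → K) →ₗ[K] (α × β → K)}

omit [Fintype α] [Fintype β] in
/-- The matrix entries of an endomorphism commuting with `D` are constant along `D`:
`f(δ_{w q})(w p) = f(δ_q)(p)`. [folklore] -/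
private theorem apply_single_prodShear
    (hf : ∀ (κ : Equiv.Perm α) (π : α → Equiv.Perm β) (y : α × β → K),
      f (y ∘ Equiv.prodShear κ π) = f y ∘ Equiv.prodShear κ π)
    (κ : Equiv.Perm α) (π : α → Equiv.Perm β) (p q : α × β) :
    f (Pi.single (Equiv.prodShear κ π q) 1) (Equiv.prodShear κ π p) = f (Pi.single q 1) p := by
  have h := hf κ π (Pi.single (Equiv.prodShear κ π q) 1)
  rw [single_comp_equiv, Equiv.symm_apply_apply] at h
  rw [h, Function.comp_apply]

omit [Fintype α] [Fintype β] in
/-- Diagonal entries are all equal. [folklore] -/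
private theorem entry_diag
    (hf : ∀ (κ : Equiv.Perm α) (π : α → Equiv.Perm β) (y : α × β → K),
      f (y ∘ Equiv.prodShear κ π) = f y ∘ Equiv.prodShear κ π)
    (p q : α × β) : f (Pi.single p 1) p = f (Pi.single q 1) q := by
  obtain ⟨κ, π, h⟩ := exists_prodShear_apply_eq p q
  have := apply_single_prodShear hf κ π p p
  rw [h] at this
  exact this.symm

omit [Fintype α] [Fintype β] in
/-- Entries at distinct points of a common group are all equal. [folklore] -/
private theorem entry_same
    (hf : ∀ (κ : Equiv.Perm α) (π : α → Equiv.Perm β) (y : α × β → K),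
      f (y ∘ Equiv.prodShear κ π) = f y ∘ Equiv.prodShear κ π)
    {p p' q q' : α × β} (hp : p.1 = p'.1) (hpne : p ≠ p') (hq : q.1 = q'.1) (hqne : q ≠ q') :
    f (Pi.single p' 1) p = f (Pi.single q' 1) q := by
  obtain ⟨κ, π, h1, h2⟩ := exists_prodShear_apply_eq_of_fst_eq hp hpne hq hqne
  have := apply_single_prodShear hf κ π p p'
  rw [h1, h2] at this
  exact this.symm

omit [Fintype α] [Fintype β] in
/-- Entries at points of different groups are all equal. [folklore] -/
private theorem entry_diff
    (hf : ∀ (κ : Equiv.Perm α) (π : α → Equiv.Perm β) (y : α × β → K),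
      f (y ∘ Equiv.prodShear κ π) = f y ∘ Equiv.prodShear κ π)
    {p p' q q' : α × β} (hp : p.1 ≠ p'.1) (hq : q.1 ≠ q'.1) :
    f (Pi.single p' 1) p = f (Pi.single q' 1) q := by
  obtain ⟨κ, π, h1, h2⟩ := exists_prodShear_apply_eq_of_fst_ne hp hq
  have := apply_single_prodShear hf κ π p p'
  rw [h1, h2] at this
  exact this.symm

/-- **The commutant of `D` on `Y`** (Schur / multiplicity-freeness in endomorphism form): a
`K`-linear endomorphism `f` of `Y` commuting with the action of `D` is of the form
`f(y) = a·y + b·(group sums of y, spread over the groups) + c·(total of y)·𝟙` — equivalently its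
matrix is constant on the three orbits of `D` on `(α × β)²` (equal, same group, different groups).
This is the algebraic content of MS's «since `λ` commutes with `D'`, we see that `λ` can be
expressed as `λ'(t)(3m·y_ij) = t^a e' + t^b Σ_{r≠i}(f'_i − f'_r) + t^c m h'_ij` (15)»; it holds
over every field `K`, with no hypothesis on the characteristic.
[cite: MulmuleySohoniSIAM2001, §8 eq. (15) (AV p.35, all.txt L2716–2720)] -/
theorem exists_eq_of_commute_prodShear
    (hf : ∀ (κ : Equiv.Perm α) (π : α → Equiv.Perm β) (y : α × β → K),
      f (y ∘ Equiv.prodShear κ π) = f y ∘ Equiv.prodShear κ π) :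
    ∃ a b c : K, ∀ (y : α × β → K) (p : α × β),
      f y p = a * y p + b * (∑ j, y (p.1, j)) + c * ∑ q, y q := by
  classical
  have hexp : ∀ (y : α × β → K) (p : α × β), f y p = ∑ q, y q * f (Pi.single q 1) p := by
    intro y p
    conv_lhs => rw [pi_eq_sum_univ' y]
    simp only [map_sum, map_smul, Finset.sum_apply, Pi.smul_apply, smul_eq_mul]
  rcases isEmpty_or_nonempty (α × β) with hαβ | ⟨⟨p₀⟩⟩
  · exact ⟨0, 0, 0, fun y p => (hαβ.false p).elim⟩
  set a₀ : K := f (Pi.single p₀ 1) p₀ with ha₀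
  set b₀ : K := if h : ∃ pp : (α × β) × (α × β), pp.1.1 = pp.2.1 ∧ pp.1 ≠ pp.2 then
      f (Pi.single h.choose.2 1) h.choose.1 else 0 with hb₀
  set c₀ : K := if h : ∃ pp : (α × β) × (α × β), pp.1.1 ≠ pp.2.1 then
      f (Pi.single h.choose.2 1) h.choose.1 else 0 with hc₀
  have hentry : ∀ p q : α × β,
      f (Pi.single q 1) p = if p = q then a₀ else if p.1 = q.1 then b₀ else c₀ := by
    intro p q
    by_cases hpq : p = q
    · subst hpq
      rw [if_pos rfl]
      exact entry_diag hf p p₀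
    · rw [if_neg hpq]
      by_cases h1 : p.1 = q.1
      · rw [if_pos h1]
        have hex : ∃ pp : (α × β) × (α × β), pp.1.1 = pp.2.1 ∧ pp.1 ≠ pp.2 := ⟨(p, q), h1, hpq⟩
        rw [hb₀, dif_pos hex]
        exact entry_same hf h1 hpq hex.choose_spec.1 hex.choose_spec.2
      · rw [if_neg h1]
        have hex : ∃ pp : (α × β) × (α × β), pp.1.1 ≠ pp.2.1 := ⟨(p, q), h1⟩
        rw [hc₀, dif_pos hex]
        exact entry_diff hf h1 hex.choose_spec
  refine ⟨a₀ - b₀, b₀ - c₀, c₀, fun y p => ?_⟩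
  have hite : ∀ q : α × β, y q * (if p = q then a₀ else if p.1 = q.1 then b₀ else c₀) =
      y q * c₀ + (if p.1 = q.1 then y q * (b₀ - c₀) else 0) +
        (if p = q then y q * (a₀ - b₀) else 0) := by
    intro q
    by_cases hpq : p = q
    · subst hpq
      simp only [if_true]
      ring
    · by_cases h1 : p.1 = q.1
      · simp only [hpq, h1, if_true, if_false]
        ring
      · simp only [hpq, h1, if_false]
        ring
  rw [hexp y p]
  simp only [hentry p, hite, Finset.sum_add_distrib, Finset.sum_ite_eq, Finset.mem_univ, if_true]
  have hgs : ∑ q : α × β, (if p.1 = q.1 then y q * (b₀ - c₀) else 0) =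
      (∑ j, y (p.1, j)) * (b₀ - c₀) := by
    rw [Fintype.sum_prod_type, Finset.sum_mul,
      Finset.sum_eq_single_of_mem p.1 (Finset.mem_univ _) fun i _ hi =>
        Finset.sum_eq_zero fun j _ => if_neg (Ne.symm hi)]
    simp only [if_true]
  rw [hgs, ← Finset.sum_mul]
  ring

/-- **A `D`-endomorphism acts on `H` by a scalar.**
[cite: MulmuleySohoniSIAM2001, §8 eq. (15) (AV p.35, all.txt L2716–2720)] -/
theorem exists_smul_of_commute_subH
    (hf : ∀ (κ : Equiv.Perm α) (π : α → Equiv.Perm β) (y : α × β → K),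
      f (y ∘ Equiv.prodShear κ π) = f y ∘ Equiv.prodShear κ π) :
    ∃ s : K, ∀ y ∈ subH K α β, f y = s • y := by
  obtain ⟨a, b, c, h⟩ := exists_eq_of_commute_prodShear hf
  refine ⟨a, fun y hy => funext fun p => ?_⟩
  rw [h y p, hy p.1, ← sum_groupSum y, Finset.sum_eq_zero fun i _ => hy i]
  simp

/-- **A `D`-endomorphism acts on `F` by a scalar.**
[cite: MulmuleySohoniSIAM2001, §8 eq. (15) (AV p.35, all.txt L2716–2720)] -/
theorem exists_smul_of_commute_subF
    (hf : ∀ (κ : Equiv.Perm α) (π : α → Equiv.Perm β) (y : α × β → K),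
      f (y ∘ Equiv.prodShear κ π) = f y ∘ Equiv.prodShear κ π) :
    ∃ s : K, ∀ y ∈ subF K α β, f y = s • y := by
  obtain ⟨a, b, c, h⟩ := exists_eq_of_commute_prodShear hf
  refine ⟨a + b * Fintype.card β, fun y hy => funext fun p => ?_⟩
  rw [h y p, hy.2, Finset.sum_congr rfl fun j _ => hy.1 (p.1, j) p rfl, Finset.sum_const,
    Finset.card_univ, nsmul_eq_mul]
  simp only [Pi.smul_apply, smul_eq_mul]
  ring

/-- **A `D`-endomorphism acts on `E` by a scalar.**
[cite: MulmuleySohoniSIAM2001, §8 eq. (15) (AV p.35, all.txt L2716–2720)] -/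
theorem exists_smul_of_commute_subE
    (hf : ∀ (κ : Equiv.Perm α) (π : α → Equiv.Perm β) (y : α × β → K),
      f (y ∘ Equiv.prodShear κ π) = f y ∘ Equiv.prodShear κ π) :
    ∃ s : K, ∀ y ∈ subE K α β, f y = s • y := by
  obtain ⟨a, b, c, h⟩ := exists_eq_of_commute_prodShear hf
  refine ⟨a + b * Fintype.card β + c * (Fintype.card α * Fintype.card β), fun y hy => ?_⟩
  obtain ⟨t, rfl⟩ := mem_subE_iff.mp hy
  funext p
  rw [h]
  simp only [Pi.smul_apply, Pi.one_apply, smul_eq_mul, mul_one, Finset.sum_const, Finset.card_univ,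
    nsmul_eq_mul, Fintype.card_prod, Nat.cast_mul]
  ring

end Commutant

section StableSubspaces

variable {U : Submodule K (α × β → K)}

/-- A `D`-stable subspace containing a vector that is not constant on some group contains `H`
(the irreducibility mechanism for `H`: `u ∘ τ − u` for the transposition `τ` of two positions of
that group is a nonzero multiple of `y_(i,j) − y_(i,j')`). [cite: MulmuleySohoniSIAM2001, §8 (AV p.34, all.txt L2640–2642)] -/
theorem subH_le_of_apply_ne (hU : IsWreathStable U) {u : α × β → K} (hu : u ∈ U) {p p' : α × β}
    (hpp : p.1 = p'.1) (hne : u p ≠ u p') : subH K α β ≤ U := by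
  have hpne : p ≠ p' := fun h => hne (by rw [h])
  have hp2 : p.2 ≠ p'.2 := fun h => hpne (Prod.ext hpp h)
  -- the transposition of `p` and `p'` inside their common group, as an element of `D`
  set w := Equiv.prodShear (1 : Equiv.Perm α)
    (fun i => if i = p.1 then Equiv.swap p.2 p'.2 else 1) with hw_def
  have hw : u ∘ w - u = (u p' - u p) • ((Pi.single p 1 : α × β → K) - Pi.single p' 1) := by
    funext q
    simp only [hw_def, Pi.sub_apply, Function.comp_apply, Equiv.prodShear_apply,
      Equiv.Perm.one_apply, Pi.smul_apply, smul_eq_mul, Pi.single_apply]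
    by_cases hq1 : q.1 = p.1
    · rw [if_pos hq1]
      by_cases hq2 : q.2 = p.2
      · have hq : q = p := Prod.ext hq1 hq2
        subst hq
        rw [Equiv.swap_apply_left, if_pos rfl, if_neg hpne,
          show (q.1, p'.2) = p' from Prod.ext hpp rfl]
        ring
      · by_cases hq2' : q.2 = p'.2
        · have hq : q = p' := Prod.ext (hq1.trans hpp) hq2'
          subst hq
          rw [Equiv.swap_apply_right, if_neg (Ne.symm hpne), if_pos rfl,
            show (q.1, p.2) = p from Prod.ext hq1 rfl]
          ring
        · have hqp : q ≠ p := fun h => hq2 (by rw [h])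
          have hqp' : q ≠ p' := fun h => hq2' (by rw [h])
          rw [Equiv.swap_apply_of_ne_of_ne hq2 hq2', if_neg hqp, if_neg hqp', Prod.mk.eta]
          ring
    · have hqp : q ≠ p := fun h => hq1 (by rw [h])
      have hqp' : q ≠ p' := fun h => hq1 (by rw [h, hpp])
      rw [if_neg hq1, Equiv.Perm.one_apply, if_neg hqp, if_neg hqp', Prod.mk.eta]
      ring
  have hmem : (u p' - u p) • ((Pi.single p 1 : α × β → K) - Pi.single p' 1) ∈ U := by
    rw [← hw]
    exact U.sub_mem (hU _ _ u hu) hu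
  have hd : (Pi.single p 1 : α × β → K) - Pi.single p' 1 ∈ U := by
    have hc : u p' - u p ≠ 0 := sub_ne_zero.mpr (Ne.symm hne)
    have := U.smul_mem (u p' - u p)⁻¹ hmem
    rwa [smul_smul, inv_mul_cancel₀ hc, one_smul] at this
  have hall : ∀ q q' : α × β, q.1 = q'.1 →
      (Pi.single q 1 : α × β → K) - Pi.single q' 1 ∈ U := by
    intro q q' hqq
    by_cases hqne : q = q'
    · subst hqne
      rw [sub_self]
      exact U.zero_mem
    · obtain ⟨κ, π, h1, h2⟩ := exists_prodShear_apply_eq_of_fst_eq hqq hqne hpp hpne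
      have h := hU κ π _ hd
      have hcomp : ((Pi.single p 1 : α × β → K) - Pi.single p' 1) ∘ Equiv.prodShear κ π =
          Pi.single q 1 - Pi.single q' 1 := by
        have e1 : (Equiv.prodShear κ π).symm p = q := by rw [← h1, Equiv.symm_apply_apply]
        have e2 : (Equiv.prodShear κ π).symm p' = q' := by rw [← h2, Equiv.symm_apply_apply]
        rw [← e1, ← e2, ← single_comp_equiv, ← single_comp_equiv]
        rfl
      rwa [hcomp] at h
  intro y hy
  have h1 : ∑ i, ∑ j, y (i, j) • (Pi.single (i, j) (1 : K) : α × β → K) = y :=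
    ((Fintype.sum_prod_type fun q : α × β => y q • (Pi.single q (1 : K) : α × β → K)).symm.trans
      (pi_eq_sum_univ' y).symm)
  have h2 : ∑ i, (∑ j, y (i, j)) • (Pi.single (i, p.2) (1 : K) : α × β → K) = 0 :=
    Finset.sum_eq_zero fun i _ => by rw [hy i, zero_smul]
  have hdecomp : y = ∑ i, ∑ j, y (i, j) • ((Pi.single (i, j) 1 : α × β → K) - Pi.single (i, p.2) 1) := by
    simp only [smul_sub, Finset.sum_sub_distrib, ← Finset.sum_smul]
    rw [h1, h2, sub_zero]
  rw [hdecomp]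
  exact U.sum_mem fun i _ => U.sum_mem fun j _ => U.smul_mem _ (hall _ _ rfl)

omit [DecidableEq β] in
/-- A `D`-stable subspace containing a group-constant vector that takes two different values
contains `F` (the irreducibility mechanism for `F`: `u ∘ τ − u` for the transposition `τ` of two
groups is a nonzero multiple of `f'_i − f'_{i'}`; «the action of `D` on `F` reduces to an action
of `S_m` on `F` which is isomorphic to the irreducible representation of `S_m` corresponding to the
partition `(m − 1, 1)`»). Hypothesis: `k ≠ 0` in `K`.
[cite: MulmuleySohoniSIAM2001, §8 (AV p.34, all.txt L2590–2594)] -/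
theorem subF_le_of_apply_ne (hU : IsWreathStable U) (hβ : (Fintype.card β : K) ≠ 0)
    {u : α × β → K} (hu : u ∈ U) (hconst : ∀ q q' : α × β, q.1 = q'.1 → u q = u q')
    {p p' : α × β} (hne : u p ≠ u p') : subF K α β ≤ U := by
  have hpp : p.1 ≠ p'.1 := fun h => hne (hconst _ _ h)
  set w := Equiv.prodShear (Equiv.swap p.1 p'.1) (fun _ => (1 : Equiv.Perm β)) with hw_def
  have hw : u ∘ w - u = (u p' - u p) • (groupInd K β p.1 - groupInd K β p'.1) := by
    funext q
    simp only [hw_def, Pi.sub_apply, Function.comp_apply, Equiv.prodShear_apply,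
      Equiv.Perm.one_apply, Pi.smul_apply, smul_eq_mul, groupInd_apply]
    by_cases h1 : q.1 = p.1
    · rw [h1, Equiv.swap_apply_left, if_pos rfl, if_neg hpp,
        hconst (p'.1, q.2) p' rfl, hconst q p h1]
      ring
    · by_cases h2 : q.1 = p'.1
      · rw [h2, Equiv.swap_apply_right, if_neg (Ne.symm hpp), if_pos rfl, hconst (p.1, q.2) p rfl,
          hconst q p' h2]
        ring
      · rw [Equiv.swap_apply_of_ne_of_ne h1 h2, if_neg h1, if_neg h2, Prod.mk.eta]
        ring
  have hmem : (u p' - u p) • (groupInd K β p.1 - groupInd K β p'.1) ∈ U := by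
    rw [← hw]
    exact U.sub_mem (hU _ _ u hu) hu
  have hd : groupInd K β p.1 - groupInd K β p'.1 ∈ U := by
    have hc : u p' - u p ≠ 0 := sub_ne_zero.mpr (Ne.symm hne)
    have := U.smul_mem (u p' - u p)⁻¹ hmem
    rwa [smul_smul, inv_mul_cancel₀ hc, one_smul] at this
  have hall : ∀ i i' : α, groupInd K β i - groupInd K β i' ∈ U := by
    intro i i'
    by_cases hii : i = i'
    · subst hii
      rw [sub_self]
      exact U.zero_mem
    · obtain ⟨κ, h1, h2⟩ := exists_perm_apply_eq_and hii hpp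
      have h := hU κ (fun _ => 1) _ hd
      have hcomp : (groupInd K β p.1 - groupInd K β p'.1) ∘ Equiv.prodShear κ (fun _ => 1) =
          groupInd K β i - groupInd K β i' := by
        have e1 : κ.symm p.1 = i := by rw [← h1, Equiv.symm_apply_apply]
        have e2 : κ.symm p'.1 = i' := by rw [← h2, Equiv.symm_apply_apply]
        rw [← e1, ← e2, ← groupInd_comp_prodShear κ (fun _ => 1), ← groupInd_comp_prodShear κ (fun _ => 1)]
        rfl
      rwa [hcomp] at h
  intro y hy
  have hsum0 : ∑ i, y (i, p.2) = 0 := by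
    have h := hy.2
    rw [Fintype.sum_prod_type, Finset.sum_congr rfl fun i _ =>
      (Finset.sum_congr rfl fun j _ => hy.1 (i, j) (i, p.2) rfl), Finset.sum_congr rfl fun i _ =>
      Finset.sum_const (y (i, p.2)), ← Finset.smul_sum, Finset.card_univ, nsmul_eq_mul] at h
    exact (mul_eq_zero.mp h).resolve_left hβ
  have hdecomp : y = ∑ i, y (i, p.2) • (groupInd K β i - groupInd K β p.1) := by
    funext q
    simp only [Finset.sum_apply, Pi.smul_apply, Pi.sub_apply, groupInd_apply, smul_eq_mul, mul_sub,
      Finset.sum_sub_distrib, mul_ite, mul_one, mul_zero, Finset.sum_ite_irrel, hsum0,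
      Finset.sum_const_zero]
    rw [hy.1 q (q.1, p.2) rfl]
    split_ifs <;> simp
  rw [hdecomp]
  exact U.sum_mem fun i _ => U.smul_mem _ (hall _ _)

omit [Fintype α] [Fintype β] [DecidableEq α] [DecidableEq β] in
/-- A subspace containing a nonzero constant vector contains `E`. [folklore] -/
private theorem subE_le_of_mem {u : α × β → K} (hu : u ∈ U) (huE : u ∈ subE K α β) (hu0 : u ≠ 0) :
    subE K α β ≤ U := by
  obtain ⟨a, rfl⟩ := mem_subE_iff.mp huE
  have ha : a ≠ 0 := by
    rintro rfl
    exact hu0 (zero_smul _ _)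
  have h1 : (1 : α × β → K) ∈ U := by
    have := U.smul_mem a⁻¹ hu
    rwa [smul_smul, inv_mul_cancel₀ ha, one_smul] at this
  intro y hy
  obtain ⟨b, rfl⟩ := mem_subE_iff.mp hy
  exact U.smul_mem b h1

/-- **The `D`-stable subspaces of `Y` are the eight sums of `E`, `F`, `H`** (multiplicity-freeness
in submodule form: «`Y = E ⊕ F ⊕ H` as `D`-modules and thus `Y` is a multiplicity-free
representation of `D`», with `E`, `F`, `H` irreducible). Hypotheses: `k ≠ 0` and `m ≠ 0` in `K`
(MS: the characteristic does not divide `k`, `m`). This is the form in which the Stab-invariance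
of a Kempf flag is consumed. [cite: MulmuleySohoniSIAM2001, §8 (AV p.34, all.txt L2566–2646)] -/
theorem exists_eq_sup_of_isWreathStable (hα : (Fintype.card α : K) ≠ 0)
    (hβ : (Fintype.card β : K) ≠ 0) (hU : IsWreathStable U) :
    ∃ E' F' H' : Submodule K (α × β → K),
      (E' = ⊥ ∨ E' = subE K α β) ∧ (F' = ⊥ ∨ F' = subF K α β) ∧ (H' = ⊥ ∨ H' = subH K α β) ∧
        U = E' ⊔ F' ⊔ H' := by
  classical
  -- `H`-components of members of `U` lie in `U`
  have hH : ∀ u ∈ U, projH K α β u ≠ 0 → subH K α β ≤ U := by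
    intro u hu hne
    obtain ⟨p, hp⟩ := Function.ne_iff.mp hne
    obtain ⟨j, hj⟩ : ∃ j, u (p.1, j) ≠ u p := by
      by_contra h
      simp only [not_exists, not_not] at h
      apply hp
      rw [Pi.zero_apply, projH_apply, Finset.sum_congr rfl fun j _ => h j, Finset.sum_const,
        Finset.card_univ, nsmul_eq_mul, inv_mul_cancel_left₀ hβ, sub_self]
    exact subH_le_of_apply_ne hU hu (p := (p.1, j)) (p' := p) rfl hj
  have hPH : ∀ u ∈ U, projH K α β u ∈ U := by
    intro u hu
    by_cases h0 : projH K α β u = 0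
    · rw [h0]
      exact U.zero_mem
    · exact hH u hu h0 (projH_mem_subH hβ u)
  -- `F`-components of members of `U` lie in `U`
  have hF : ∀ u ∈ U, projF K α β u ≠ 0 → subF K α β ≤ U := by
    intro u hu hne
    have hv : u - projH K α β u ∈ U := U.sub_mem hu (hPH u hu)
    have hvq : ∀ q : α × β, (u - projH K α β u) q = (Fintype.card β : K)⁻¹ * ∑ j, u (q.1, j) := by
      intro q
      simp [projH_apply]
    obtain ⟨p, hp⟩ := Function.ne_iff.mp hne
    obtain ⟨i', hi'⟩ : ∃ i', ∑ j, u (p.1, j) ≠ ∑ j, u (i', j) := by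
      by_contra h
      simp only [not_exists, not_not] at h
      apply hp
      rw [Pi.zero_apply, projF_apply, ← sum_groupSum u, Finset.sum_congr rfl fun i _ => (h i).symm,
        Finset.sum_const, Finset.card_univ, nsmul_eq_mul]
      field_simp
      ring
    refine subF_le_of_apply_ne hU hβ hv (fun q q' hqq => by rw [hvq, hvq, hqq]) (p := p)
      (p' := (i', p.2)) ?_
    rw [hvq, hvq]
    exact fun h => hi' (mul_left_cancel₀ (inv_ne_zero hβ) h)
  have hPF : ∀ u ∈ U, projF K α β u ∈ U := by
    intro u hu
    by_cases h0 : projF K α β u = 0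
    · rw [h0]
      exact U.zero_mem
    · exact hF u hu h0 (projF_mem_subF hα hβ u)
  -- `E`-components of members of `U` lie in `U`
  have hE : ∀ u ∈ U, projE K α β u ≠ 0 → subE K α β ≤ U := by
    intro u hu hne
    have hmem : projE K α β u ∈ U := by
      have h := U.sub_mem (U.sub_mem hu (hPF u hu)) (hPH u hu)
      have heq : u - projF K α β u - projH K α β u = projE K α β u := by
        have h3 := projE_add_projF_add_projH (K := K) (α := α) (β := β) u
        funext q
        have h3q := congrFun h3 q
        simp only [Pi.add_apply, Pi.sub_apply] at h3q ⊢
        rw [← h3q]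
        ring
      rwa [heq] at h
    exact subE_le_of_mem hmem (projE_mem_subE u) hne
  refine ⟨if ∃ u ∈ U, projE K α β u ≠ 0 then subE K α β else ⊥,
    if ∃ u ∈ U, projF K α β u ≠ 0 then subF K α β else ⊥,
    if ∃ u ∈ U, projH K α β u ≠ 0 then subH K α β else ⊥, ?_, ?_, ?_, ?_⟩
  · by_cases h : ∃ u ∈ U, projE K α β u ≠ 0 <;> simp [h]
  · by_cases h : ∃ u ∈ U, projF K α β u ≠ 0 <;> simp [h]
  · by_cases h : ∃ u ∈ U, projH K α β u ≠ 0 <;> simp [h]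
  · apply le_antisymm
    · intro u hu
      rw [← projE_add_projF_add_projH u]
      refine Submodule.add_mem_sup (Submodule.add_mem_sup ?_ ?_) ?_
      · by_cases h0 : projE K α β u = 0
        · rw [h0]
          exact Submodule.zero_mem _
        · rw [if_pos ⟨u, hu, h0⟩]
          exact projE_mem_subE u
      · by_cases h0 : projF K α β u = 0
        · rw [h0]
          exact Submodule.zero_mem _
        · rw [if_pos ⟨u, hu, h0⟩]
          exact projF_mem_subF hα hβ u
      · by_cases h0 : projH K α β u = 0
        · rw [h0]
          exact Submodule.zero_mem _
        · rw [if_pos ⟨u, hu, h0⟩]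
          exact projH_mem_subH hβ u
    · refine sup_le (sup_le ?_ ?_) ?_
      · split_ifs with h
        · obtain ⟨u, hu, hne⟩ := h
          exact hE u hu hne
        · exact bot_le
      · split_ifs with h
        · obtain ⟨u, hu, hne⟩ := h
          exact hF u hu hne
        · exact bot_le
      · split_ifs with h
        · obtain ⟨u, hu, hne⟩ := h
          exact hH u hu hne
        · exact bot_le

/-- **`H` is `D`-irreducible** («It is easy to show that `H` is also `D`-irreducible»); hypothesis
`k ≠ 0` in `K`. [cite: MulmuleySohoniSIAM2001, §8 (AV p.34, all.txt L2640–2642)] -/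
theorem eq_bot_or_eq_of_le_subH (hβ : (Fintype.card β : K) ≠ 0) (hU : IsWreathStable U)
    (hle : U ≤ subH K α β) : U = ⊥ ∨ U = subH K α β := by
  by_cases h : U = ⊥
  · exact Or.inl h
  · refine Or.inr (le_antisymm hle ?_)
    obtain ⟨u, hu, hu0⟩ := (Submodule.ne_bot_iff U).mp h
    obtain ⟨p, hp⟩ := Function.ne_iff.mp hu0
    obtain ⟨j, hj⟩ : ∃ j, u (p.1, j) ≠ u p := by
      by_contra h'
      simp only [not_exists, not_not] at h'
      have hs := hle hu p.1
      rw [Finset.sum_congr rfl fun j _ => h' j, Finset.sum_const, Finset.card_univ,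
        nsmul_eq_mul] at hs
      exact hp ((mul_eq_zero.mp hs).resolve_left hβ)
    exact subH_le_of_apply_ne hU hu (p := (p.1, j)) (p' := p) rfl hj

omit [DecidableEq β] in
/-- **`F` is `D`-irreducible** («`E` and `F` are, in fact, irreducible representations of `D`»);
hypotheses `k ≠ 0`, `m ≠ 0` in `K`. [cite: MulmuleySohoniSIAM2001, §8 (AV p.34, all.txt L2570–2594)] -/
theorem eq_bot_or_eq_of_le_subF (hα : (Fintype.card α : K) ≠ 0) (hβ : (Fintype.card β : K) ≠ 0)
    (hU : IsWreathStable U) (hle : U ≤ subF K α β) : U = ⊥ ∨ U = subF K α β := by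
  by_cases h : U = ⊥
  · exact Or.inl h
  · refine Or.inr (le_antisymm hle ?_)
    obtain ⟨u, hu, hu0⟩ := (Submodule.ne_bot_iff U).mp h
    obtain ⟨p, hp⟩ := Function.ne_iff.mp hu0
    obtain ⟨p', hp'⟩ : ∃ p', u p ≠ u p' := by
      by_contra h'
      simp only [not_exists, not_not] at h'
      have hs := (hle hu).2
      rw [Finset.sum_congr rfl fun q _ => (h' q).symm, Finset.sum_const, Finset.card_univ,
        nsmul_eq_mul, Fintype.card_prod, Nat.cast_mul] at hs
      exact hp ((mul_eq_zero.mp hs).resolve_left (mul_ne_zero hα hβ))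
    exact subF_le_of_apply_ne hU hβ hu (hle hu).1 hp'

omit [Fintype α] [Fintype β] [DecidableEq α] [DecidableEq β] in
/-- **`E` is irreducible** («Irreducibility of `E` is clear»: it is a line).
[cite: MulmuleySohoniSIAM2001, §8 (AV p.34, all.txt L2570)] -/
theorem eq_bot_or_eq_of_le_subE (hle : U ≤ subE K α β) : U = ⊥ ∨ U = subE K α β := by
  by_cases h : U = ⊥
  · exact Or.inl h
  · obtain ⟨u, hu, hu0⟩ := (Submodule.ne_bot_iff U).mp h
    exact Or.inr (le_antisymm hle (subE_le_of_mem hu (hle hu) hu0))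

end StableSubspaces

end MS2001Wreath

end Literature.Computability.AlgebraicComplexity
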